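import Literature.MathematicalPhysics.QuantumLattice.HubbardFermiRadius
import Literature.MathematicalPhysics.QuantumLattice.HubbardFermiVelocity
import Mathlib.Analysis.Calculus.ImplicitContDiff
import Mathlib.Analysis.SpecialFunctions.Trigonometric.Deriv
import Mathlib.Analysis.Calculus.Deriv.Prod
import HarnessLib

/-!
# The Fermi radius `u(θ)` is a smooth (indeed real-analytic) function of the angle

Topic `Literature/MathematicalPhysics/QuantumLattice`; completes `HubbardFermiRadius.lean`
(existence, uniqueness, continuity and symmetries of the polar Fermi radius `u(θ) = fermiRadius μ θ`
of the square-lattice dispersion `ε(k) = -2(cos k₁ + cos k₂)` for `-4 < μ < -2 - √2`) with the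
one property of Benfatto–Giuliani–Mastropietro's description that was left open there:
"`Σ_F^{(0)}` is a **smooth** convex closed curve … parameterized as `k⃗ = p⃗_F^{(0)}(θ)` in terms of
the polar angle" (BGM 2006, §1 after (1.4), p. 2 of the arXiv text; the smoothness of `u(θ)` and
bounds on its derivatives are what the sector geometry of §2.4 and App. A3 consume).

**Proof** (the implicit function theorem, Mathlib `ContDiffAt.implicitFunction` /
`contDiffAt_implicitFunction`, 2026). The level function `F(θ, t) = ε(t · dir θ) =
-2(cos(t cos θ) + cos(t sin θ))` is real-analytic on `ℝ²` (`contDiff_rayDispersion`); its partial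
`t`-derivative at `(θ, u(θ))` is `∂_t F = 2(cos θ sin(u cos θ) + sin θ sin(u sin θ)) = (∇ε·k)/u > 0`
by the transversality bound of `HubbardFermiVelocity.lean` (`radialDeriv_pos_of_sqDispersion_eq`,
`u > 0`), so `∂_t F(θ₀, u(θ₀))` is invertible and the implicit function `ψ` through
`(θ₀, u(θ₀))` is `C^ω`; since `u` is continuous (`continuous_fermiRadius`) and solves
`F(θ, u(θ)) = μ`, the local uniqueness clause of the implicit function theorem gives `u = ψ` near
`θ₀`. Hence:

* `contDiff_fermiRadius` — **`θ ↦ u(θ)` is `C^n` for every `n ≤ ω`** (real-analytic, in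
  particular `C^∞`);
* `hasDerivAt_fermiRadius` — the derivative, by differentiating `F(θ, u(θ)) = μ`:
  `u'(θ) = -∂_θF/∂_tF = u (sin θ sin(u cos θ) - cos θ sin(u sin θ)) / (cos θ sin(u cos θ) + sin θ sin(u sin θ))`.

Everything is PROVED; the definitions are `rayDispersion` (the level function `F`), its two
partial derivatives `rayDispersionDθ`, `rayDispersionDt`, and `fermiRadiusDeriv` (the closed
form of `u'`). [folklore]

## Mathlib / tree search

Mathlib: `ContDiffAt.implicitFunction`, `ContDiffAt.contDiffAt_implicitFunction`,
`ContDiffAt.eventually_apply_eq_iff_implicitFunction` (`Mathlib.Analysis.Calculus.ImplicitContDiff`),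
`ContinuousLinearEquiv.unitsEquivAut` (invertibility of a non-zero scalar), `Real.contDiff_cos/sin`.
Tree: `HubbardFermiRadius` (`fermiRadius`, `continuous_fermiRadius`, `sqDispersion_fermiRadius`,
`fermiRadius_pos`, `abs_fermiRadius_mul_dir_lt`), `HubbardFermiVelocity` (`radialDeriv`,
`radialDeriv_pos_of_sqDispersion_eq`, `hasDerivAt_sqDispersion_ray`).

## Sources

G. Benfatto, A. Giuliani, V. Mastropietro, Ann. Henri Poincaré 7 (2006) 809–898, §1 (1.4)–(1.5)
and §2.4 (`BenfattoGiulianiMastropietro2006`).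
-/

noncomputable section

open Real Set Filter
open scoped Topology ContDiff

namespace Literature.MathematicalPhysics.QuantumLattice

/-! ### The level function `F(θ, t) = ε(t · dir θ)` and its partial derivatives -/

/-- The level function of the polar parametrisation: `F(θ, t) = ε(t · dir θ)`. [folklore] -/
def rayDispersion (p : ℝ × ℝ) : ℝ := sqDispersion (p.2 • dir p.1)

/-- `F(θ, t) = -2 (cos (t cos θ) + cos (t sin θ))`. [folklore] -/
theorem rayDispersion_eq (p : ℝ × ℝ) :
    rayDispersion p = -2 * (Real.cos (p.2 * Real.cos p.1) + Real.cos (p.2 * Real.sin p.1)) := by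
  simp [rayDispersion, sqDispersion, dir, smul_eq_mul]

/-- The level function is real-analytic (hence `C^n` for every `n`). [folklore] -/
theorem contDiff_rayDispersion {n : WithTop ℕ∞} : ContDiff ℝ n rayDispersion := by
  rw [show rayDispersion = fun p : ℝ × ℝ =>
      -2 * (Real.cos (p.2 * Real.cos p.1) + Real.cos (p.2 * Real.sin p.1)) from funext rayDispersion_eq]
  refine contDiff_const.mul (ContDiff.add ?_ ?_)
  · exact Real.contDiff_cos.comp (contDiff_snd.mul (Real.contDiff_cos.comp contDiff_fst))
  · exact Real.contDiff_cos.comp (contDiff_snd.mul (Real.contDiff_sin.comp contDiff_fst))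

/-- The partial `θ`-derivative `∂_θ F(θ, t) = 2t (cos θ sin(t sin θ) - sin θ sin(t cos θ))`. [folklore] -/
def rayDispersionDθ (θ t : ℝ) : ℝ :=
  2 * t * (Real.cos θ * Real.sin (t * Real.sin θ) - Real.sin θ * Real.sin (t * Real.cos θ))

/-- The partial `t`-derivative `∂_t F(θ, t) = 2 (cos θ sin(t cos θ) + sin θ sin(t sin θ))`. [folklore] -/
def rayDispersionDt (θ t : ℝ) : ℝ :=
  2 * (Real.cos θ * Real.sin (t * Real.cos θ) + Real.sin θ * Real.sin (t * Real.sin θ))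

/-- `∂_θ F`: the derivative of `θ ↦ F(θ, t)`. [folklore] -/
theorem hasDerivAt_rayDispersion_angle (θ t : ℝ) :
    HasDerivAt (fun ϑ => rayDispersion (ϑ, t)) (rayDispersionDθ θ t) θ := by
  have h0 : HasDerivAt (fun ϑ => Real.cos (t * Real.cos ϑ)) (-Real.sin (t * Real.cos θ) * (t * -Real.sin θ)) θ :=
    ((Real.hasDerivAt_cos θ).const_mul t).cos
  have h1 : HasDerivAt (fun ϑ => Real.cos (t * Real.sin ϑ)) (-Real.sin (t * Real.sin θ) * (t * Real.cos θ)) θ :=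
    ((Real.hasDerivAt_sin θ).const_mul t).cos
  have h := (h0.add h1).const_mul (-2 : ℝ)
  simp only [rayDispersion_eq]
  refine h.congr_deriv ?_
  rw [rayDispersionDθ]
  ring

/-- `∂_t F`: the derivative of `t ↦ F(θ, t)` (the derivative of the dispersion along the ray,
`hasDerivAt_sqDispersion_ray`). [folklore] -/
theorem hasDerivAt_rayDispersion_radius (θ t : ℝ) :
    HasDerivAt (fun s => rayDispersion (θ, s)) (rayDispersionDt θ t) t := by
  have h := hasDerivAt_sqDispersion_ray (dir θ) t
  refine h.congr_deriv ?_
  simp [rayDispersionDt, dir]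

/-- `t · ∂_t F(θ, t) = ∇ε(k)·k` at `k = t · dir θ` (`radialDeriv`). [folklore] -/
theorem mul_rayDispersionDt (θ t : ℝ) : t * rayDispersionDt θ t = radialDeriv (t • dir θ) := by
  simp [rayDispersionDt, radialDeriv, dir, smul_eq_mul]
  ring

/-- The Fréchet derivative of `F` in terms of the two partials:
`DF(θ, t)(a, b) = a ∂_θF + b ∂_tF`. [folklore] -/
theorem fderiv_rayDispersion_apply (θ t a b : ℝ) :
    fderiv ℝ rayDispersion (θ, t) (a, b) = a * rayDispersionDθ θ t + b * rayDispersionDt θ t := by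
  have hF : HasFDerivAt rayDispersion (fderiv ℝ rayDispersion (θ, t)) (θ, t) :=
    ((contDiff_rayDispersion (n := 1)).differentiable one_ne_zero (θ, t)).hasFDerivAt
  -- the two partial derivatives, by composing with the coordinate lines and uniqueness
  have h1 : fderiv ℝ rayDispersion (θ, t) (1, 0) = rayDispersionDθ θ t := by
    have hg : HasDerivAt (fun ϑ : ℝ => ((ϑ, t) : ℝ × ℝ)) ((1 : ℝ), (0 : ℝ)) θ :=
      (hasDerivAt_id θ).prodMk (hasDerivAt_const θ t)
    have hc : HasDerivAt (rayDispersion ∘ fun ϑ : ℝ => ((ϑ, t) : ℝ × ℝ))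
        (fderiv ℝ rayDispersion (θ, t) (1, 0)) θ :=
      HasFDerivAt.comp_hasDerivAt (l := rayDispersion) (f := fun ϑ : ℝ => ((ϑ, t) : ℝ × ℝ)) θ hF hg
    exact hc.unique (hasDerivAt_rayDispersion_angle θ t)
  have h2 : fderiv ℝ rayDispersion (θ, t) (0, 1) = rayDispersionDt θ t := by
    have hg : HasDerivAt (fun s : ℝ => ((θ, s) : ℝ × ℝ)) ((0 : ℝ), (1 : ℝ)) t :=
      (hasDerivAt_const t θ).prodMk (hasDerivAt_id t)
    have hc : HasDerivAt (rayDispersion ∘ fun s : ℝ => ((θ, s) : ℝ × ℝ))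
        (fderiv ℝ rayDispersion (θ, t) (0, 1)) t :=
      HasFDerivAt.comp_hasDerivAt (l := rayDispersion) (f := fun s : ℝ => ((θ, s) : ℝ × ℝ)) t hF hg
    exact hc.unique (hasDerivAt_rayDispersion_radius θ t)
  have hab : ((a, b) : ℝ × ℝ) = a • ((1 : ℝ), (0 : ℝ)) + b • ((0 : ℝ), (1 : ℝ)) := by
    ext <;> simp
  rw [hab, map_add, map_smul, map_smul, h1, h2, smul_eq_mul, smul_eq_mul]

/-- The Fréchet derivative of `F` restricted to the `t`-direction is multiplication by `∂_t F`. [folklore] -/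
theorem fderiv_rayDispersion_comp_inr_apply (θ t c : ℝ) :
    (fderiv ℝ rayDispersion (θ, t) ∘L ContinuousLinearMap.inr ℝ ℝ ℝ) c = c * rayDispersionDt θ t := by
  rw [ContinuousLinearMap.comp_apply, ContinuousLinearMap.inr_apply, fderiv_rayDispersion_apply,
    zero_mul, zero_add]

/-- Where `∂_t F ≠ 0` the `t`-partial is an invertible linear map `ℝ → ℝ` (the hypothesis of the
implicit function theorem). [folklore] -/
theorem isInvertible_fderiv_rayDispersion_comp_inr {θ t : ℝ} (h : rayDispersionDt θ t ≠ 0) :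
    (fderiv ℝ rayDispersion (θ, t) ∘L ContinuousLinearMap.inr ℝ ℝ ℝ).IsInvertible := by
  refine ⟨ContinuousLinearEquiv.unitsEquivAut ℝ (Units.mk0 _ h), ContinuousLinearMap.ext_ring ?_⟩
  rw [ContinuousLinearEquiv.coe_coe, ContinuousLinearEquiv.unitsEquivAut_apply, Units.val_mk0,
    fderiv_rayDispersion_comp_inr_apply]

/-! ### Smoothness of the Fermi radius -/

section Range

variable {μ : ℝ} (hμ₁ : -4 < μ) (hμ₂ : μ < -2 - Real.sqrt 2)
include hμ₁ hμ₂

/-- **Transversality**: on the Fermi curve `∂_t F(θ, u(θ)) = (∇ε·k)/u(θ) > 0`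
(`radialDeriv_pos_of_sqDispersion_eq`, `u(θ) > 0`). [cite: BenfattoGiulianiMastropietro2006, §1 (1.5)] -/
theorem rayDispersionDt_fermiRadius_pos (θ : ℝ) : 0 < rayDispersionDt θ (fermiRadius μ θ) := by
  have ht : 0 < fermiRadius μ θ := fermiRadius_pos hμ₁ hμ₂ θ
  have hk : ∀ i, |(fermiRadius μ θ • dir θ) i| ≤ π / 2 := fun i => by
    have := (abs_fermiRadius_mul_dir_lt hμ₁ hμ₂ θ i).le
    simp only [Pi.smul_apply, smul_eq_mul]
    linarith [Real.pi_pos]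
  have hpos := radialDeriv_pos_of_sqDispersion_eq hμ₁ hk (sqDispersion_fermiRadius hμ₁ hμ₂ θ)
  rw [← mul_rayDispersionDt] at hpos
  exact pos_of_mul_pos_right hpos ht.le

/-- **The Fermi radius is smooth — indeed real-analytic — in the angle**: for
`-4 < μ < -2 - √2`, `θ ↦ u(θ)` is `C^n` on `ℝ` for every `n ≤ ω` (implicit function theorem at
every point of the curve, transversality `∂_t F > 0`, and local uniqueness against the continuous
solution `u`). BGM 2006, §1: "`Σ_F^{(0)}` is a smooth convex closed curve … parameterized … in terms
of the polar angle `θ`". [cite: BenfattoGiulianiMastropietro2006, §1 (1.4)-(1.5)] -/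
theorem contDiff_fermiRadius {n : WithTop ℕ∞} : ContDiff ℝ n (fermiRadius μ) := by
  suffices h : ContDiff ℝ ω (fermiRadius μ) from h.of_le le_top
  refine contDiff_iff_contDiffAt.2 fun θ₀ => ?_
  have cdf : ContDiffAt ℝ ω rayDispersion (θ₀, fermiRadius μ θ₀) := contDiff_rayDispersion.contDiffAt
  have pn : (ω : WithTop ℕ∞) ≠ 0 := by simp
  have if₂ := isInvertible_fderiv_rayDispersion_comp_inr
    (rayDispersionDt_fermiRadius_pos hμ₁ hμ₂ θ₀).ne'
  -- the implicit function through `(θ₀, u(θ₀))` is `C^ω` …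
  have hψ : ContDiffAt ℝ ω (cdf.implicitFunction pn if₂) θ₀ := cdf.contDiffAt_implicitFunction pn if₂
  -- … and coincides with `u` near `θ₀` by local uniqueness, `u` being a continuous solution
  have hev := cdf.eventually_apply_eq_iff_implicitFunction pn if₂
  have hcont : Tendsto (fun θ : ℝ => ((θ, fermiRadius μ θ) : ℝ × ℝ)) (𝓝 θ₀)
      (𝓝 (θ₀, fermiRadius μ θ₀)) :=
    (continuous_id.prodMk (continuous_fermiRadius hμ₁ hμ₂)).tendsto θ₀
  have heq : fermiRadius μ =ᶠ[𝓝 θ₀] cdf.implicitFunction pn if₂ := by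
    filter_upwards [hcont.eventually hev] with θ hθ
    have hF : rayDispersion (θ, fermiRadius μ θ) = rayDispersion (θ₀, fermiRadius μ θ₀) := by
      simp only [rayDispersion]
      rw [sqDispersion_fermiRadius hμ₁ hμ₂, sqDispersion_fermiRadius hμ₁ hμ₂]
    exact (hθ.1 hF).symm
  exact hψ.congr_of_eventuallyEq heq

/-- `u` is differentiable. [folklore] -/
theorem differentiable_fermiRadius : Differentiable ℝ (fermiRadius μ) :=
  (contDiff_fermiRadius hμ₁ hμ₂ (n := 1)).differentiable one_ne_zero

/-- The closed form of `u'(θ) = -∂_θF/∂_tF` at `t = u(θ)`: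
`u (sin θ sin(u cos θ) - cos θ sin(u sin θ)) / (cos θ sin(u cos θ) + sin θ sin(u sin θ))` up to the
common factor `2`. [folklore] -/
def fermiRadiusDeriv (μ θ : ℝ) : ℝ :=
  -rayDispersionDθ θ (fermiRadius μ θ) / rayDispersionDt θ (fermiRadius μ θ)

omit hμ₁ hμ₂ in
/-- Unfolding of `fermiRadiusDeriv`. [folklore] -/
theorem fermiRadiusDeriv_eq (θ : ℝ) :
    fermiRadiusDeriv μ θ =
      -(2 * fermiRadius μ θ * (Real.cos θ * Real.sin (fermiRadius μ θ * Real.sin θ) -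
          Real.sin θ * Real.sin (fermiRadius μ θ * Real.cos θ))) /
        (2 * (Real.cos θ * Real.sin (fermiRadius μ θ * Real.cos θ) +
          Real.sin θ * Real.sin (fermiRadius μ θ * Real.sin θ))) := rfl

/-- **The derivative of the Fermi radius**: differentiating `F(θ, u(θ)) = μ` gives
`∂_θF + u'·∂_tF = 0`, i.e. `u'(θ) = -∂_θF/∂_tF` (`fermiRadiusDeriv`). [cite: BenfattoGiulianiMastropietro2006, §1 (1.5)] -/
theorem hasDerivAt_fermiRadius (θ : ℝ) : HasDerivAt (fermiRadius μ) (fermiRadiusDeriv μ θ) θ := by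
  have hu : HasDerivAt (fermiRadius μ) (deriv (fermiRadius μ) θ) θ :=
    (differentiable_fermiRadius hμ₁ hμ₂ θ).hasDerivAt
  -- the chain rule for `θ ↦ F(θ, u(θ))`, which is the constant `μ`
  have hF : HasFDerivAt rayDispersion (fderiv ℝ rayDispersion (θ, fermiRadius μ θ)) (θ, fermiRadius μ θ) :=
    ((contDiff_rayDispersion (n := 1)).differentiable one_ne_zero _).hasFDerivAt
  have hg : HasDerivAt (fun ϑ : ℝ => ((ϑ, fermiRadius μ ϑ) : ℝ × ℝ)) ((1 : ℝ), deriv (fermiRadius μ) θ) θ :=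
    (hasDerivAt_id θ).prodMk hu
  have hG : HasDerivAt (rayDispersion ∘ fun ϑ : ℝ => ((ϑ, fermiRadius μ ϑ) : ℝ × ℝ))
      (fderiv ℝ rayDispersion (θ, fermiRadius μ θ) (1, deriv (fermiRadius μ) θ)) θ :=
    HasFDerivAt.comp_hasDerivAt (l := rayDispersion)
      (f := fun ϑ : ℝ => ((ϑ, fermiRadius μ ϑ) : ℝ × ℝ)) θ hF hg
  have hG0 : HasDerivAt (rayDispersion ∘ fun ϑ : ℝ => ((ϑ, fermiRadius μ ϑ) : ℝ × ℝ)) 0 θ := by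
    have : (rayDispersion ∘ fun ϑ : ℝ => ((ϑ, fermiRadius μ ϑ) : ℝ × ℝ)) = fun _ => μ :=
      funext fun ϑ => sqDispersion_fermiRadius hμ₁ hμ₂ ϑ
    rw [this]
    exact hasDerivAt_const θ μ
  have hrel := hG.unique hG0
  rw [fderiv_rayDispersion_apply, one_mul] at hrel
  -- solve `∂_θF + u' ∂_tF = 0` for `u'`
  have hDt : rayDispersionDt θ (fermiRadius μ θ) ≠ 0 := (rayDispersionDt_fermiRadius_pos hμ₁ hμ₂ θ).ne'
  have hval : deriv (fermiRadius μ) θ = fermiRadiusDeriv μ θ := by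
    rw [fermiRadiusDeriv, eq_div_iff hDt]
    linarith
  rwa [hval] at hu

/-- `deriv u = fermiRadiusDeriv μ`. [folklore] -/
theorem deriv_fermiRadius (θ : ℝ) : deriv (fermiRadius μ) θ = fermiRadiusDeriv μ θ :=
  (hasDerivAt_fermiRadius hμ₁ hμ₂ θ).deriv

/-- The derivative of the Fermi radius is continuous (indeed `u ∈ C^ω`). [folklore] -/
theorem continuous_fermiRadiusDeriv : Continuous (fermiRadiusDeriv μ) := by
  have h := (contDiff_fermiRadius hμ₁ hμ₂ (n := 1)).continuous_deriv le_rfl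
  exact h.congr fun θ => deriv_fermiRadius hμ₁ hμ₂ θ

end Range

end Literature.MathematicalPhysics.QuantumLattice

end
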